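import Summits.CriticalPhenomena.PercolationContinuityZ3.Theorems.Transplant.SkelPhiFaceSchedBoxes
import HarnessLib

/-!
# N1 ({±1} node), (F) inner route, part R5b-ii′ (hp-8 g33): **THE RUN SCHEDULES' REGIONS AS EXPLICIT BOXES** — `region k = [aLo k − R′ − La,
# aHi k + R′ + La] × [bLo k − R′ − Lb, bHi k + R′ + Lb]` of the run frame, for the x-run and the y′-run schedules.  Needed because a DRIFTING run
# (the y′-run, `d = v_L`) must be read region by region: its prism hull `[…] × [−N|v|−…, N|v|+…]` over-reads the axis-`0` cell coordinate by
# `≈ N·|v_α|/n` strides (the rectangle ignores the correlation `α ≈ k·v_α, β′ ≈ k·nℓ` along the chain of cores).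
builds on p205010 (kernel theorem, internal audit signed; external expert review pending) — nothing in this file uses p205010; no claim about the open node.
Lane `prim-bschramm`, seat `prim-hp-8` (gen 33); helper file (`--supports stmt-CriticalPhenomena-4575 --as helper`).
* `Skelφ.scheduleN_region_subset_pt`, **`xRunSched_region_subset`**, **`yRunSched_region_subset`**.
[cite: KozmaNitzan2024, §4 Lemma 11 (pp. 22–23)] [cite: MartineauTassion2017, §4.3 Lemma 4.2]
-/

noncomputable section

open scoped Classical

namespace Summit.CriticalPhenomena.PercolationContinuityZ3.Theorems.Transplant

namespace Skelφ

open Literature.Probability.Percolation Literature.Probability.LatticeModels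
open Literature.Probability.Percolation.KozmaNitzan.Cells (oth)
open ChainPlanar ChainPara

/-- Region `k` of a run schedule along axis `0`, sign `1`, origin `0` is the explicit box of `InRegion k`. [folklore] -/
theorem scheduleN_region_subset_pt (P : RunPrm) (hP : RunOK P) (heb : P.eb = P.ea) (k : ℕ) :
    (P.scheduleN 0 (σ := 1) (Or.inl rfl) 0 hP heb).region k ⊆
      Finset.Icc (pt (P.aLo k - P.ea - P.La) (P.bLo k - P.eb - P.Lb)) (pt (P.aHi k + P.ea + P.La) (P.bHi k + P.eb + P.Lb)) := by
  intro y hy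
  rw [RunPrm.scheduleN_region, RunPrm.mem_pregion_iff (Or.inl rfl)] at hy
  obtain ⟨h1, h2, h3, h4⟩ := hy
  simp only [Pi.zero_apply, sub_zero, one_mul, show oth (0 : Fin 2) = 1 from rfl] at h1 h2 h3 h4
  rw [mem_Icc_pt_iff]
  exact ⟨⟨h1, h2⟩, h3, h4⟩

/-- **The x-run's region `k`** as an explicit box: `[k·n − q − (k+1)R′ − n, k·n + q + (k+1)R′ + n] × [−(W + (k+1)R′) − Lb, W + (k+1)R′ + Lb]`,
`W = nℓ/U + 1`, `Lb = 3nℓ/U + 1`. [folklore] -/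
theorem xRunSched_region_subset (n ℓ : ℕ) (h : ℤ) (R' q N k : ℕ) :
    (xRunSched n ℓ h R' q N).region k ⊆
      Finset.Icc (pt ((k : ℤ) * n - q - (k : ℤ) * R' - R' - n) (-((((n * ℓ / shearUnit n h + 1 : ℕ) : ℤ)) + (k : ℤ) * R') - R' - ((3 * (n * ℓ) / shearUnit n h + 1 : ℕ) : ℤ)))
        (pt ((k : ℤ) * n + q + (k : ℤ) * R' + R' + n) (((n * ℓ / shearUnit n h + 1 : ℕ) : ℤ) + (k : ℤ) * R' + R' + ((3 * (n * ℓ) / shearUnit n h + 1 : ℕ) : ℤ))) := by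
  have h0 := scheduleN_region_subset_pt (xPrmW n ℓ h R' q N) (xPrmW_ok n ℓ h R' q N) (xPrmW_eb n ℓ h R' q N) k
  rw [xRunSched]
  refine h0.trans (le_of_eq ?_)
  simp [xPrmW, RunPrm.aLo, RunPrm.aHi, RunPrm.bLo, RunPrm.bHi]

/-- **The y′-run's region `k`** as an explicit box: `[k·sLo − q − (k+1)R′ − La, k·sHi + q + (k+1)R′ + La] × [k·v − ((n+v)⁺ + (k+1)R′) − n,
k·v + (n−v)⁺ + (k+1)R′ + n]`, `La = 3nℓ/U + 1`. [folklore] -/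
theorem yRunSched_region_subset {n ℓ : ℕ} {h v : ℤ} (hn : 1 ≤ n) (hv : |v| ≤ n) (hlay : (n + h.natAbs : ℕ) ≤ (n : ℤ) * ℓ + 1) (R' q N k : ℕ) :
    (yRunSched hn hv hlay R' q N).region k ⊆
      Finset.Icc (pt ((k : ℤ) * (((n : ℤ) * ℓ - (shearUnit n h : ℕ) + 1) / (shearUnit n h : ℕ)) - q - (k : ℤ) * R' - R' - ((3 * (n * ℓ) / shearUnit n h + 1 : ℕ) : ℤ))
          ((k : ℤ) * v - ((((((n : ℤ) + v).toNat : ℕ) : ℤ)) + (k : ℤ) * R') - R' - n))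
        (pt ((k : ℤ) * ((n : ℤ) * ℓ / (shearUnit n h : ℕ) + 1) + q + (k : ℤ) * R' + R' + ((3 * (n * ℓ) / shearUnit n h + 1 : ℕ) : ℤ))
          ((k : ℤ) * v + (((((n : ℤ) - v).toNat : ℕ) : ℤ) + (k : ℤ) * R') + R' + n)) := by
  have h0 := scheduleN_region_subset_pt (yPrmW n ℓ h v R' q N) (yPrmW_ok hn hv hlay R' q N) (yPrmW_eb n ℓ h v R' q N) k
  rw [yRunSched]
  refine h0.trans (le_of_eq ?_)
  simp [yPrmW, RunPrm.aLo, RunPrm.aHi, RunPrm.bLo, RunPrm.bHi]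

end Skelφ

end Summit.CriticalPhenomena.PercolationContinuityZ3.Theorems.Transplant

end
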